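import Mathlib
import HarnessLib

/-!
# Second differences under subdivision: `‖f(2n) − 2f(n) + f(0)‖ ≤ n² · max_l ‖f(l+2) − 2f(l+1) + f(l)‖`

The `ℓ = 1` comparison of two multiplier Gaussians "without smallness"
(`norm_integral_mulMat_sub_le_of_sum_sq_segment`) subdivides the segment of multipliers into `n ≳ q h_T`
pieces and telescopes the small-step bounds.  The `ℓ = 2` analogue (the genuine second-order part
`E_{C₂} − 2E_{C̄} + E_{C₀}` of the second difference of Gaussian expectations along a linear kernel segment)
needs the corresponding SECOND-ORDER subdivision identity: a global second difference over `2n` equal steps is a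
double sum of `n²` local second differences, hence at most `n²` times the largest local one.  This file records
that elementary step in a normed group:

* `sub_two_smul_add_eq_sum_sum_secondDiff` — `f(2n) − 2f(n) + f(0) = Σ_{i<n} Σ_{l<n} Δ²f(i+l)`,
  `Δ²f(m) = f(m+2) − 2f(m+1) + f(m)`;
* **`norm_sub_two_smul_add_le_sq_mul`** — `‖f(2n) − 2f(n) + f(0)‖ ≤ n²·D` if `‖Δ²f(m)‖ ≤ D` for `m + 2 ≤ 2n`.

## References
* S. Buchholz, J. Funct. Anal. 275 (2018), Thm 4.5 (proof: subdivision of the interpolation) [Buchholz2016].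
* S. Adams, S. Buchholz, R. Kotecký, S. Müller, arXiv:1910.13564, Lemma 12.6 (12.51) [AdamsBuchholzKoteckyMuller2019].
-/

namespace Literature.MathematicalPhysics.StatisticalMechanics.GradientRG

open Finset

variable {E : Type*} [SeminormedAddCommGroup E] [NormedSpace ℝ E]

/-- **Subdivision identity for second differences**:
`f(2n) − 2f(n) + f(0) = Σ_{i<n} Σ_{l<n} (f(i+l+2) − 2f(i+l+1) + f(i+l))`.
[cite: Buchholz2016, Thm 4.5 (proof)] -/
theorem sub_two_smul_add_eq_sum_sum_secondDiff (f : ℕ → E) (n : ℕ) :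
    f (2 * n) - (2 : ℝ) • f n + f 0 =
      ∑ i ∈ range n, ∑ l ∈ range n, (f (i + l + 2) - (2 : ℝ) • f (i + l + 1) + f (i + l)) := by
  -- first differences
  set g : ℕ → E := fun m => f (m + 1) - f m with hg
  have h1 : f (2 * n) - f n = ∑ i ∈ range n, g (n + i) := by
    have := Finset.sum_range_sub (fun i => f (n + i)) n
    simp only [add_zero] at this
    rw [two_mul, ← this]
    refine Finset.sum_congr rfl fun i _ => ?_
    simp only [hg]; rw [show n + (i + 1) = n + i + 1 by ring]
  have h1' : f (2 * n) - f n = ∑ i ∈ range n, g (n + i) := h1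
  have h2 : f n - f 0 = ∑ i ∈ range n, g i := (Finset.sum_range_sub f n).symm
  have h3 : ∀ i, g (n + i) - g i = ∑ l ∈ range n, (g (i + l + 1) - g (i + l)) := by
    intro i
    have := Finset.sum_range_sub (fun l => g (i + l)) n
    simp only [add_zero] at this
    rw [show n + i = i + n by ring, ← this]
    refine Finset.sum_congr rfl fun l _ => ?_
    rw [show i + (l + 1) = i + l + 1 by ring]
  have h4 : ∀ m, g (m + 1) - g m = f (m + 2) - (2 : ℝ) • f (m + 1) + f m := by
    intro m
    simp only [hg, two_smul]
    rw [show m + 1 + 1 = m + 2 by ring]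
    abel
  calc f (2 * n) - (2 : ℝ) • f n + f 0 = (f (2 * n) - f n) - (f n - f 0) := by rw [two_smul]; abel
    _ = ∑ i ∈ range n, (g (n + i) - g i) := by rw [h1', h2, ← Finset.sum_sub_distrib]
    _ = ∑ i ∈ range n, ∑ l ∈ range n, (g (i + l + 1) - g (i + l)) := Finset.sum_congr rfl fun i _ => h3 i
    _ = ∑ i ∈ range n, ∑ l ∈ range n, (f (i + l + 2) - (2 : ℝ) • f (i + l + 1) + f (i + l)) :=
        Finset.sum_congr rfl fun i _ => Finset.sum_congr rfl fun l _ => h4 (i + l)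

/-- **`‖f(2n) − 2f(n) + f(0)‖ ≤ n²·D`** if every local second difference `f(m+2) − 2f(m+1) + f(m)`,
`m + 2 ≤ 2n`, has norm at most `D`. [cite: Buchholz2016, Thm 4.5 (proof)] -/
theorem norm_sub_two_smul_add_le_sq_mul (f : ℕ → E) (n : ℕ) {D : ℝ}
    (hD : ∀ m, m + 2 ≤ 2 * n → ‖f (m + 2) - (2 : ℝ) • f (m + 1) + f m‖ ≤ D) :
    ‖f (2 * n) - (2 : ℝ) • f n + f 0‖ ≤ (n : ℝ) ^ 2 * D := by
  rw [sub_two_smul_add_eq_sum_sum_secondDiff]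
  calc ‖∑ i ∈ range n, ∑ l ∈ range n, (f (i + l + 2) - (2 : ℝ) • f (i + l + 1) + f (i + l))‖
      ≤ ∑ i ∈ range n, ‖∑ l ∈ range n, (f (i + l + 2) - (2 : ℝ) • f (i + l + 1) + f (i + l))‖ := norm_sum_le _ _
    _ ≤ ∑ i ∈ range n, ∑ l ∈ range n, ‖f (i + l + 2) - (2 : ℝ) • f (i + l + 1) + f (i + l)‖ :=
        sum_le_sum fun i _ => norm_sum_le _ _
    _ ≤ ∑ i ∈ range n, ∑ l ∈ range n, D := by
        refine sum_le_sum fun i hi => sum_le_sum fun l hl => hD (i + l) ?_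
        have hi' := mem_range.1 hi
        have hl' := mem_range.1 hl
        omega
    _ = (n : ℝ) ^ 2 * D := by simp [sum_const, card_range]; ring

end Literature.MathematicalPhysics.StatisticalMechanics.GradientRG
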